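import Summits.ResolutionOfSingularities.KangarooAtlas.MizutaniFieldAut
import Summits.ResolutionOfSingularities.KangarooAtlas.MizutaniCoordChangeHironaka
import Summits.ResolutionOfSingularities.KangarooAtlas.MizutaniExponentCriterion
import HarnessLib

/-!
# The numerical invariants of the Hironaka-scheme dictionary are «type» invariants

Cell `pub-rosobs`, Mizutani enclosure (seat mizutani-encloser-2, gen 9).  AI-written; *AI review is weaker than expert review*;
NOT a resolution-of-singularities theorem (summit relevance C).

Mizutani 1973, p. 87: two pairs `(V, W)`, `(V', W')` (and the H-schemes they define) are of the SAME TYPE when they correspond under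
an automorphism `σ` of `k` followed by a `k`-linear change of the variables.  `MizutaniCoordChange` / `MizutaniCoordChangeHironaka`
(`σ_M = aeval (linForm (M ·))`, `M ∈ GL_{n+1}(k)`) and `MizutaniFieldAutHironaka` / `MizutaniFieldAut` (`τ_σ = MvPolynomial.map σ`,
`σ : k ≃+* k`) made every OBJECT of the dictionary equivariant and proved the invariance of `exponent` and `dim B` (`hsDim`).  This file adds
the remaining NUMERICAL invariants level by level — the numbers a classification of extremal schemes by type (Remark 2.10) reads off:

* `finrank_eq_of_comp_mem_iff` — a `σ`-semilinear bijection `a ↦ σ ∘ a` between two `k`-subspaces of `k^{n+1}` preserves `dim_k`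
  (`rank_eq_of_equiv_equiv`);
* under `τ_σ`: `mem_pointForms_comap_map_iff` (`V_e(τ⁻¹𝔭) = σ^*V_e(𝔭)`), **`finrank_pointForms_comap_map`**, **`cdim_comap_map`**
  (`cdim_e = dim_k span{ξ_i^{p^e}}`, through `cdim_e + dim V_e = n + 1`), **`finrank_invForms_comap_map`**, `finrank_hirForms_comap_map`,
  **`hsDimAt_comap_map`**, `hsDim_comap_map_of_isPrime` (no `IsPoint` hypothesis);
* under `σ_M`: `mem_pointForms_comap_aeval_iff` (`V_e(σ_M⁻¹𝔭) = (M^{[p^e]})^* V_e(𝔭)`), `pointForms_comap_aeval_eq`, **`finrank_pointForms_comap_aeval`**,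
  **`cdim_comap_aeval`**, `finrank_hirForms_comap_aeval` (`M` invertible).

With `exponent_comap(_map)`, `hsDim_comap(_map)`, `finrank_invForms_comap` (earlier files): `e ↦ (dim (U∩L)_e, dim (L_B)_e, dim V_e, cdim_e, hsDimAt_e)`,
`exponent`, `dim B` are all invariants of the type.  References: [Mizutani1973HironakaGroupSchemes] p. 87, Remark 2.10; [Oda1983HironakaGroupSchemeII] §2.
-/

noncomputable section

open MvPolynomial Literature.AlgebraicGeometry.Resolution Literature.AlgebraicGeometry.Resolution.HironakaScheme
open Literature.RingTheory.MvPolynomial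

namespace Summit.ResolutionOfSingularities.KangarooAtlas.Mizutani

universe u

section Semilinear

variable (k : Type u) [Field k] {n : ℕ} (σ : k ≃+* k)

/-- **A `σ`-semilinear bijection preserves `dim_k`**: if `N' = {a : σ ∘ a ∈ N}` for `k`-subspaces `N, N' ⊆ k^{n+1}` and `σ ∈ Aut(k)`, then
`dim_k N' = dim_k N` (`a ↦ σ ∘ a` is an additive bijection `N' → N` with `σ ∘ (c·a) = σ(c)·(σ ∘ a)`). [folklore] -/
theorem finrank_eq_of_comp_mem_iff {N N' : Submodule k (Fin (n + 1) → k)} (h : ∀ a, a ∈ N' ↔ (fun j => σ (a j)) ∈ N) :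
    Module.finrank k N' = Module.finrank k N := by
  have hback : ∀ b : Fin (n + 1) → k, b ∈ N → (fun j => σ.symm (b j)) ∈ N' := fun b hb => by
    refine (h _).mpr ?_
    have hb' : (fun j => σ ((fun j => σ.symm (b j)) j)) = b := funext fun j => σ.apply_symm_apply _
    rw [hb']
    exact hb
  let j : N' ≃+ N :=
    { toFun := fun a => ⟨fun i => σ (a.1 i), (h a.1).mp a.2⟩
      invFun := fun b => ⟨fun i => σ.symm (b.1 i), hback b.1 b.2⟩
      left_inv := fun a => Subtype.ext (funext fun i => σ.symm_apply_apply _)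
      right_inv := fun b => Subtype.ext (funext fun i => σ.apply_symm_apply _)
      map_add' := fun a b => Subtype.ext (funext fun i => by
        simp only [Submodule.coe_add, Pi.add_apply, map_add]) }
  have hr : Module.rank k N' = Module.rank k N :=
    rank_eq_of_equiv_equiv σ j σ.bijective fun c a => Subtype.ext (funext fun i => by
      change σ ((c • a).1 i) = σ c * σ (a.1 i)
      rw [Submodule.coe_smul, Pi.smul_apply, smul_eq_mul, map_mul])
  simp only [Module.finrank, hr]

end Semilinear

section FieldAut

variable (k : Type u) [Field k] (p : ℕ) [hp : Fact p.Prime] [CharP k p] {n : ℕ} (σ : k ≃+* k)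
  (𝔭 : Ideal (MvPolynomial (Fin (n + 1)) k))

omit hp [CharP k p] in
/-- **`V_e` is `Aut(k)`-equivariant**: `a ∈ V_e(τ_σ⁻¹𝔭) ↔ σ ∘ a ∈ V_e(𝔭)` (`τ_σ (Σ a_j X_j^{p^e}) = Σ σ(a_j) X_j^{p^e}`).
[cite: Mizutani1973HironakaGroupSchemes, §1 (a), p. 87 (type)] -/
theorem mem_pointForms_comap_map_iff (e : ℕ) (a : Fin (n + 1) → k) :
    a ∈ pointForms k p (𝔭.comap (MvPolynomial.map (σ : k →+* k))) e ↔ (fun j => σ (a j)) ∈ pointForms k p 𝔭 e := by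
  rw [mem_pointForms_iff, mem_pointForms_iff, Ideal.mem_comap, map_addForm]

omit hp [CharP k p] in
/-- **`dim_k V_e` is `Aut(k)`-invariant.** [cite: Mizutani1973HironakaGroupSchemes, p. 87 (type), Thm. 1.3] -/
theorem finrank_pointForms_comap_map (e : ℕ) :
    Module.finrank k (pointForms k p (𝔭.comap (MvPolynomial.map (σ : k →+* k))) e) = Module.finrank k (pointForms k p 𝔭 e) :=
  finrank_eq_of_comp_mem_iff k σ fun a => mem_pointForms_comap_map_iff k p σ 𝔭 e a

omit hp [CharP k p] in
/-- **`cdim_e = dim_k span{ξ_i^{p^e}}` is `Aut(k)`-invariant** (through `cdim_e + dim V_e = n + 1`). [cite: Mizutani1973HironakaGroupSchemes, p. 87 (type)] -/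
theorem cdim_comap_map (e : ℕ) : cdim k p (𝔭.comap (MvPolynomial.map (σ : k →+* k))) e = cdim k p 𝔭 e := by
  have h1 := cdim_add_finrank_pointForms k p (𝔭.comap (MvPolynomial.map (σ : k →+* k))) e
  have h2 := cdim_add_finrank_pointForms k p 𝔭 e
  rw [finrank_pointForms_comap_map] at h1
  omega

/-- **`dim_k (L_B)_e` is `Aut(k)`-invariant** (primes). [cite: Oda1983HironakaGroupSchemeII, §2 (p. 1168)] -/
theorem finrank_invForms_comap_map [𝔭.IsPrime] (e : ℕ) :
    Module.finrank k (invForms k p (𝔭.comap (MvPolynomial.map (σ : k →+* k))) e) = Module.finrank k (invForms k p 𝔭 e) :=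
  finrank_eq_of_comp_mem_iff k σ fun a => mem_invForms_comap_map_iff k p σ 𝔭 e a

omit hp [CharP k p] in
/-- **`dim_k (U ∩ L)_e` is `Aut(k)`-invariant** (primes). [cite: Mizutani1973HironakaGroupSchemes, §1 (c), p. 87 (type)] -/
theorem finrank_hirForms_comap_map [𝔭.IsPrime] (e : ℕ) :
    Module.finrank k (hirForms k p (𝔭.comap (MvPolynomial.map (σ : k →+* k))) e) = Module.finrank k (hirForms k p 𝔭 e) :=
  finrank_eq_of_comp_mem_iff k σ fun a => mem_hirForms_comap_map_iff k p σ 𝔭 e a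

/-- **`hsDimAt_e = n + 1 − dim (L_B)_e` is `Aut(k)`-invariant** (primes). [cite: Oda1983HironakaGroupSchemeII, §2 (p. 1168: dim B)] -/
theorem hsDimAt_comap_map [𝔭.IsPrime] (e : ℕ) :
    hsDimAt k p (𝔭.comap (MvPolynomial.map (σ : k →+* k))) e = hsDimAt k p 𝔭 e := by
  unfold hsDimAt
  rw [finrank_invForms_comap_map]

/-- **`dim B` is `Aut(k)`-invariant for every prime** (`MizutaniFieldAut.hsDim_comap_map` assumed a point and went through `ringKrullDim`).
[cite: Mizutani1973HironakaGroupSchemes, Thm. 1.3; Oda1983HironakaGroupSchemeII, §2] -/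
theorem hsDim_comap_map_of_isPrime [𝔭.IsPrime] :
    hsDim k p (𝔭.comap (MvPolynomial.map (σ : k →+* k))) = hsDim k p 𝔭 := by
  unfold hsDim
  rw [exponent_comap_map, hsDimAt_comap_map]

end FieldAut

section CoordChange

variable (k : Type u) [Field k] (p : ℕ) [hp : Fact p.Prime] [CharP k p] {n : ℕ}
  (M : Matrix (Fin (n + 1)) (Fin (n + 1)) k)

/-- **`V_e` twists by `M^{[p^e]}`**: `a ∈ V_e(σ_M⁻¹𝔭) ↔ a ᵥ* M^{[p^e]} ∈ V_e(𝔭)` (`σ_M (addForm e a) = addForm e (a ᵥ* M^{[p^e]})`; the tree's other spelling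
`aeval B.toMvPolynomial` is the same map by `toMvPolynomial_eq_linForm`). [cite: Mizutani1973HironakaGroupSchemes, §1 (a), p. 87 (type)] -/
theorem mem_pointForms_comap_aeval_iff (𝔭 : Ideal (MvPolynomial (Fin (n + 1)) k)) (e : ℕ) (a : Fin (n + 1) → k) :
    a ∈ pointForms k p (𝔭.comap (aeval fun j => linForm (M j))) e ↔
      Matrix.vecMul a (M.map fun x => x ^ p ^ e) ∈ pointForms k p 𝔭 e := by
  rw [mem_pointForms_iff, mem_pointForms_iff, Ideal.mem_comap, aeval_linForm_addForm]

/-- The same as subspaces: `V_e(σ_M⁻¹𝔭) = (M^{[p^e]})^* V_e(𝔭)`. [cite: Mizutani1973HironakaGroupSchemes, §1 (a)] -/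
theorem pointForms_comap_aeval_eq (𝔭 : Ideal (MvPolynomial (Fin (n + 1)) k)) (e : ℕ) :
    pointForms k p (𝔭.comap (aeval fun j => linForm (M j))) e =
      (pointForms k p 𝔭 e).comap (Matrix.vecMulLinear (M.map fun x => x ^ p ^ e)) := by
  ext a
  rw [mem_pointForms_comap_aeval_iff, Submodule.mem_comap]
  rfl

variable {M}

/-- **`dim_k V_e` is a projective invariant** (`M` invertible). [cite: Mizutani1973HironakaGroupSchemes, p. 87 (type), Thm. 1.3] -/
theorem finrank_pointForms_comap_aeval (hM : IsUnit M.det) (𝔭 : Ideal (MvPolynomial (Fin (n + 1)) k)) (e : ℕ) :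
    Module.finrank k (pointForms k p (𝔭.comap (aeval fun j => linForm (M j))) e) = Module.finrank k (pointForms k p 𝔭 e) := by
  set T := LinearEquiv.ofBijective _ (bijective_vecMulLinear_map_pow k p hM e) with hT
  have h : pointForms k p (𝔭.comap (aeval fun j => linForm (M j))) e =
      (pointForms k p 𝔭 e).comap (T : (Fin (n + 1) → k) →ₗ[k] (Fin (n + 1) → k)) := by
    rw [pointForms_comap_aeval_eq]; rfl
  rw [h, Submodule.comap_equiv_eq_map_symm]
  exact LinearEquiv.finrank_map_eq _ _

/-- **`cdim_e` is a projective invariant** (`M` invertible; through `cdim_e + dim V_e = n + 1`). [cite: Mizutani1973HironakaGroupSchemes, p. 87 (type)] -/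
theorem cdim_comap_aeval (hM : IsUnit M.det) (𝔭 : Ideal (MvPolynomial (Fin (n + 1)) k)) (e : ℕ) :
    cdim k p (𝔭.comap (aeval fun j => linForm (M j))) e = cdim k p 𝔭 e := by
  have h1 := cdim_add_finrank_pointForms k p (𝔭.comap (aeval fun j => linForm (M j))) e
  have h2 := cdim_add_finrank_pointForms k p 𝔭 e
  rw [finrank_pointForms_comap_aeval k p hM] at h1
  omega

/-- **`dim_k (U ∩ L)_e` is a projective invariant** (`M` invertible, primes; Oda's equality `(U∩L)_e = (L_B)_e` on both sides).
[cite: Mizutani1973HironakaGroupSchemes, §1 (c), p. 87 (type)] -/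
theorem finrank_hirForms_comap_aeval (hM : IsUnit M.det) (𝔭 : Ideal (MvPolynomial (Fin (n + 1)) k)) [𝔭.IsPrime] (e : ℕ) :
    Module.finrank k (hirForms k p (𝔭.comap (aeval fun j => linForm (M j))) e) = Module.finrank k (hirForms k p 𝔭 e) := by
  rw [hirForms_eq_invForms, hirForms_eq_invForms 𝔭 e]
  exact finrank_invForms_comap k p hM 𝔭 e

end CoordChange

end Summit.ResolutionOfSingularities.KangarooAtlas.Mizutani

end
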